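import Literature.Analysis.FluidPDE.LerayResolvedEnergy
import Literature.Analysis.FluidPDE.LerayResolvedEnergyDistributional
import Literature.Analysis.FluidPDE.CoarseGrainingEstimates
import Literature.Analysis.FunctionSpaces.DistributionalConstancy
import Literature.Analysis.FunctionSpaces.DuBoisReymondAE
import HarnessLib

/-!
# The resolved energy balance of Leray solutions on `T^d` (Drivas–Eyink 2019, Lemma 2) — discharge

Analysis/FluidPDE file, theorem-only: **discharge of the named fact
`Torus.IsLerayHopfOn.resolvedEnergyBalance`** (`FluidPDE/LerayResolvedEnergy`; Drivas–Eyink,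
*An Onsager singularity theorem for Leray solutions of incompressible Navier–Stokes*,
Nonlinearity 32 (2019) = arXiv:1710.05205, §2, proof of Lemma 2, the display "global balance of
resolved energy"), as `Torus.IsLerayHopfOn.resolvedEnergyBalance_holds`. Together with
`Literature.Barriers.AnomalousDissipation.DrivasEyink2019_lemma1_measurable_of_resolvedEnergyBalance`
(`Barriers/AnomalousDissipation/OnsagerSingularityLerayProofs`) this discharges the barrier
`DrivasEyink2019_lemma1_measurable` (Drivas–Eyink 2019, Lemma 1).

## The argument

The distributional form of the balance,
`d/dt E(ū) = Π_K[u] - ν‖∇ū‖₂² + ∫⟪f̄, ū⟫` in `𝒟'(0,T)` (`ū = u ⋆ K_ε`), is the sibling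
`Torus.IsWeakNSSolutionForcedOn.resolvedEnergyBalance_distrib`
(`FluidPDE/LerayResolvedEnergyDistributional`). Here:
* the three right-hand sides are integrable on `(0,T)` (`IsLerayHopfOn.integrableOn_cetFlux`,
  `IsLerayHopfOn.integrableOn_gradNormSq_vecConv`, `IsLerayHopfOn.integrableOn_integral_inner_vecConv`;
  printed: "each term of the integrand … belong[s] to `L¹([0,T]; L¹(T^d))`"): measurable in time
  through the joint measurability of `u`, `f` (all derivatives fall on the kernel), and bounded
  through `‖(vᵢ ⋆ k)‖_∞ ≤ ‖k‖_∞ ‖v‖₁` and the uniform energy bound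
  `E(u(t)) ≤ E(u₀) + ∫₀ᵀ|∫⟪f,u⟫|` of the Leray–Hopf energy inequality
  (`IsLerayHopfOn.kineticEnergy_le`; the forcing work is integrable for `L²_{t,x}` data,
  `integrableOn_integral_inner_of_sq`);
* `t ↦ E(ū(t))` is continuous on `(0,T]` with limit `E(ū₀)` at `0⁺`
  (`IsLerayHopfOn.continuousOn_kineticEnergy_vecConv`): `(u(t) ⋆ K)(x)ᵢ = ∫⟪u(t), K(x-·)eᵢ⟫` is
  continuous in `t` by the weak `L²` continuity built into `Torus.IsLerayHopfOn`, and dominated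
  convergence on the compact torus applies;
* with `g` the integrable right-hand side and `V(t) = ∫₀ᵗ g`, the integration by parts
  `∫θ'V = -∫θg` (`Literature.Analysis.FunctionSpaces.setIntegral_deriv_mul_primitive`) and the
  distributional balance give `∫θ'(E(ū) - V) = 0` for all `θ ∈ C_c^∞(0,T)`, so `E(ū) - V` is
  a.e. constant (`Literature.Analysis.FunctionSpaces.ae_eq_const_of_forall_setIntegral_deriv_mul_eq_zero`),
  constant on `(0,T]` by continuity (Mathlib's `Measure.eqOn_of_ae_eq`), and the constant is
  `E(ū₀)` by the limit at `0⁺`.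
(The printed proof instead integrates in time the pointwise-in-`x` balance of the absolutely
continuous `t ↦ ū_ℓ(x,t)` and then over `T^d` by Fubini; the two routes agree on the stated
global balance.)

## Mathlib search

Mathlib (this pin): dominated continuity/convergence of parametric integrals
(`continuousOn_of_dominated`, `tendsto_integral_filter_of_dominated_convergence`), a.e.-equal
continuous functions agree (`Measure.eqOn_of_ae_eq`), primitives of integrable functions are
continuous (`intervalIntegral.continuous_primitive`); no Navier–Stokes content. The du
Bois-Reymond ingredients are the tree's `DistributionalConstancy`, `DuBoisReymondAE`.

## References

* T. D. Drivas, G. L. Eyink, Nonlinearity 32 (2019) 4465–4482 = arXiv:1710.05205, Lemma 2 and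
  §2, proof of Lemma 2. [DrivasEyink2019]
* H. Brezis, *Functional Analysis, Sobolev Spaces and PDE* (2011), Lemma 8.1 (vanishing
  distributional derivative). [Brezis2011]
-/

noncomputable section

open MeasureTheory TopologicalSpace Set Function Filter Metric
open _root_.Topology
open scoped ENNReal NNReal Convolution ContDiff InnerProductSpace

namespace Literature.Analysis.FluidPDE

namespace Torus

variable {d : Type*} [Fintype d]

/-! ## Slice bounds for mollified fields -/

section SliceBounds

/-- `‖v‖ ≤ 1 + ‖v‖²`, hence `∫‖v‖ ≤ 1 + 2E(v)` for `v ∈ L²(T^d)`. [folklore] -/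
theorem integral_norm_le_one_add_two_mul_kineticEnergy {v : UnitAddTorus d → EuclideanSpace ℝ d}
    (hv : MemLp v 2 volume) : ∫ y, ‖v y‖ ≤ 1 + 2 * FunctionSpaces.Torus.kineticEnergy v := by
  have h1 : ∫ y, ‖v y‖ ≤ ∫ y, (1 + ‖v y‖ ^ 2) := by
    refine integral_mono_of_nonneg (Eventually.of_forall fun y => norm_nonneg _)
      ((integrable_const 1).add (hv.integrable_norm_pow two_ne_zero)) (Eventually.of_forall fun y => ?_)
    show ‖v y‖ ≤ 1 + ‖v y‖ ^ 2
    nlinarith [norm_nonneg (v y), sq_nonneg (‖v y‖ - 1)]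
  rw [integral_add (integrable_const 1) (hv.integrable_norm_pow two_ne_zero)] at h1
  simp only [integral_const, smul_eq_mul, Measure.real, measure_univ, ENNReal.toReal_one, one_mul] at h1
  unfold FunctionSpaces.Torus.kineticEnergy
  linarith

/-- A component of a vector field is integrable with `∫|vᵢ| ≤ ∫‖v‖`. [folklore] -/
theorem integral_abs_apply_le {v : UnitAddTorus d → EuclideanSpace ℝ d} (hv : Integrable v volume) (i : d) :
    ∫ y, ‖v y i‖ ≤ ∫ y, ‖v y‖ :=
  integral_mono ((EuclideanSpace.proj (𝕜 := ℝ) i).integrable_comp hv).norm hv.norm fun y =>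
    PiLp.norm_apply_le (v y) i

/-- **Sup bound for a mollified component**: `|(vᵢ ⋆ k)(x)| ≤ C ∫‖v‖` if `‖k‖ ≤ C`. [folklore] -/
theorem abs_apply_convolution_le {v : UnitAddTorus d → EuclideanSpace ℝ d} (hv : Integrable v volume)
    {k : UnitAddTorus d → ℝ} {C : ℝ} (hC : ∀ x, ‖k x‖ ≤ C) (hC0 : 0 ≤ C) (i : d) (x : UnitAddTorus d) :
    |((fun y => v y i) ⋆ k) x| ≤ C * ∫ y, ‖v y‖ := by
  have h := FunctionSpaces.Torus.norm_convolution_le ((EuclideanSpace.proj (𝕜 := ℝ) i).integrable_comp hv) hC x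
  rw [Real.norm_eq_abs] at h
  exact h.trans (mul_le_mul_of_nonneg_left (integral_abs_apply_le hv i) hC0)

/-- **Sup bound for a mollified product of components**: `|((vᵢvⱼ) ⋆ k)(x)| ≤ C ∫‖v‖²`. [folklore] -/
theorem abs_mul_convolution_le {v : UnitAddTorus d → EuclideanSpace ℝ d} (hv : MemLp v 2 volume)
    {k : UnitAddTorus d → ℝ} {C : ℝ} (hC : ∀ x, ‖k x‖ ≤ C) (hC0 : 0 ≤ C) (i j : d) (x : UnitAddTorus d) :
    |((fun y => v y i * v y j) ⋆ k) x| ≤ C * ∫ y, ‖v y‖ ^ 2 := by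
  have hvi : ∀ i, MemLp (fun y => v y i) 2 volume := fun i => hv.eval_piLp i
  have hij : Integrable (fun y => v y i * v y j) volume := (hvi i).integrable_mul (hvi j)
  have h := FunctionSpaces.Torus.norm_convolution_le hij hC x
  rw [Real.norm_eq_abs] at h
  refine h.trans (mul_le_mul_of_nonneg_left ?_ hC0)
  refine integral_mono hij.norm (hv.integrable_norm_pow two_ne_zero) fun y => ?_
  show ‖v y i * v y j‖ ≤ ‖v y‖ ^ 2
  rw [norm_mul, sq]
  exact mul_le_mul (PiLp.norm_apply_le (v y) i) (PiLp.norm_apply_le (v y) j) (norm_nonneg _) (norm_nonneg _)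

/-- The norm of a mollified field at a point: `‖(v ⋆ k)(x)‖ ≤ d C ∫‖v‖`. [folklore] -/
theorem norm_vecConv_apply_le [DecidableEq d] {v : UnitAddTorus d → EuclideanSpace ℝ d} (hv : Integrable v volume)
    {k : UnitAddTorus d → ℝ} {C : ℝ} (hC : ∀ x, ‖k x‖ ≤ C) (hC0 : 0 ≤ C) (x : UnitAddTorus d) :
    ‖vecConv v k x‖ ≤ Fintype.card d * (C * ∫ y, ‖v y‖) := by
  calc ‖vecConv v k x‖ ≤ ∑ i, ‖vecConv v k x i‖ := norm_le_sum_norm_apply _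
    _ ≤ ∑ _i : d, C * ∫ y, ‖v y‖ := Finset.sum_le_sum fun i _ => by
        rw [vecConv_apply, Real.norm_eq_abs]; exact abs_apply_convolution_le hv hC hC0 i x
    _ = Fintype.card d * (C * ∫ y, ‖v y‖) := by simp

end SliceBounds


/-! ## Uniform energy bound and integrability of the three right-hand sides -/

section Integrability

variable [DecidableEq d] {T ν : ℝ} {f u : ℝ → UnitAddTorus d → EuclideanSpace ℝ d}
  {u₀ : UnitAddTorus d → EuclideanSpace ℝ d}

/-- **Uniform energy bound of a Leray–Hopf solution**: if the forcing work `s ↦ ∫⟪f(s), u(s)⟫`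
is integrable on `(0,T)` and `ν ≥ 0`, then `E(u(t)) ≤ E(u₀) + ∫₀ᵀ |∫⟪f, u⟫|` for every
`t ∈ [0,T]` (the energy inequality from `0`, dropping the dissipation). [folklore] -/
theorem IsLerayHopfOn.kineticEnergy_le (h : IsLerayHopfOn T ν f u₀ u) (hν : 0 ≤ ν)
    (hA : IntegrableOn (fun s => ∫ x, ⟪f s x, u s x⟫_ℝ) (Ioo 0 T)) {t : ℝ} (ht : t ∈ Icc 0 T) :
    FunctionSpaces.Torus.kineticEnergy (u t) ≤
      FunctionSpaces.Torus.kineticEnergy u₀ + ∫ s in Ioo 0 T, ‖∫ x, ⟪f s x, u s x⟫_ℝ‖ := by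
  have hen := h.energy_ineq_zero t ht
  have hD : 0 ≤ ν * (∫⁻ τ in Ioo 0 t, FunctionSpaces.Torus.eGradNormSq (u τ)).toReal :=
    mul_nonneg hν ENNReal.toReal_nonneg
  have hint : (∫ τ in (0 : ℝ)..t, ∫ x, ⟪f τ x, u τ x⟫_ℝ) ≤ ∫ s in Ioo 0 T, ‖∫ x, ⟪f s x, u s x⟫_ℝ‖ := by
    rw [intervalIntegral.integral_of_le ht.1, integral_Ioc_eq_integral_Ioo]
    have hsub : Ioo 0 t ⊆ Ioo 0 T := Ioo_subset_Ioo_right ht.2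
    calc ∫ s in Ioo 0 t, ∫ x, ⟪f s x, u s x⟫_ℝ ≤ ‖∫ s in Ioo 0 t, ∫ x, ⟪f s x, u s x⟫_ℝ‖ := Real.le_norm_self _
      _ ≤ ∫ s in Ioo 0 t, ‖∫ x, ⟪f s x, u s x⟫_ℝ‖ := norm_integral_le_integral_norm _
      _ ≤ ∫ s in Ioo 0 T, ‖∫ x, ⟪f s x, u s x⟫_ℝ‖ :=
          setIntegral_mono_set hA.norm (Eventually.of_forall fun s => norm_nonneg _) hsub.eventuallyLE
  linarith

/-- `∫‖u(t)‖ ≤ 1 + 2(E(u₀) + ∫₀ᵀ|∫⟪f,u⟫|)` for every slice of a Leray–Hopf solution. [folklore] -/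
theorem IsLerayHopfOn.integral_norm_le (h : IsLerayHopfOn T ν f u₀ u) (hν : 0 ≤ ν)
    (hA : IntegrableOn (fun s => ∫ x, ⟪f s x, u s x⟫_ℝ) (Ioo 0 T)) {t : ℝ} (ht : t ∈ Icc 0 T) :
    ∫ y, ‖u t y‖ ≤ 1 + 2 * (FunctionSpaces.Torus.kineticEnergy u₀ + ∫ s in Ioo 0 T, ‖∫ x, ⟪f s x, u s x⟫_ℝ‖) :=
  (integral_norm_le_one_add_two_mul_kineticEnergy (h.memLp t ht)).trans
    (by linarith [h.kineticEnergy_le hν hA ht])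

/-- `∫‖u(t)‖² ≤ 2(E(u₀) + ∫₀ᵀ|∫⟪f,u⟫|)` for every slice of a Leray–Hopf solution. [folklore] -/
theorem IsLerayHopfOn.integral_norm_sq_le (h : IsLerayHopfOn T ν f u₀ u) (hν : 0 ≤ ν)
    (hA : IntegrableOn (fun s => ∫ x, ⟪f s x, u s x⟫_ℝ) (Ioo 0 T)) {t : ℝ} (ht : t ∈ Icc 0 T) :
    ∫ y, ‖u t y‖ ^ 2 ≤ 2 * (FunctionSpaces.Torus.kineticEnergy u₀ + ∫ s in Ioo 0 T, ‖∫ x, ⟪f s x, u s x⟫_ℝ‖) := by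
  have := h.kineticEnergy_le hν hA ht
  unfold FunctionSpaces.Torus.kineticEnergy at this ⊢
  linarith

/-- **The mollified flux of a Leray–Hopf solution is integrable in time** (Drivas–Eyink 2019,
§2, proof of Lemma 2: "each term of the integrand … belong[s] to `L¹([0,T]; L¹(T^d))`"):
`s ↦ Π_{K_ε}[u(s)]` is integrable on `(0,T)` — measurable in `s` through the joint measurability
of `u` (the derivative falls on the kernel, `∂ᵢ(uⱼ ⋆ K) = uⱼ ⋆ ∂ᵢK`), and bounded by
`d² ‖K‖_∞ ‖∇K‖_∞ ‖u(s)‖₂² ‖u(s)‖₁`, uniformly in `s` by the energy bound. [cite: DrivasEyink2019, §2, proof of Lemma 2] -/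
theorem IsLerayHopfOn.integrableOn_cetFlux (h : IsLerayHopfOn T ν f u₀ u) (hν : 0 ≤ ν)
    (hA : IntegrableOn (fun s => ∫ x, ⟪f s x, u s x⟫_ℝ) (Ioo 0 T)) {ε : ℝ} (hε : 0 < ε) (hε' : ε ≤ 1 / 4) :
    IntegrableOn (fun s => cetFlux (FunctionSpaces.Torus.kernel ε) (u s)) (Ioo 0 T) := by
  set μ : Measure (ℝ × UnitAddTorus d) := (volume.restrict (Ioo 0 T)).prod volume with hμ
  have hKs : FunctionSpaces.Torus.IsSmooth (FunctionSpaces.Torus.kernel (d := d) ε) := FunctionSpaces.Torus.isSmooth_kernel hε hε'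
  have hKc : Continuous (FunctionSpaces.Torus.kernel (d := d) ε) := hKs.continuous
  obtain ⟨CK, hCK⟩ := FunctionSpaces.Torus.exists_forall_norm_le_of_continuous hKc
  have hCK0 : 0 ≤ CK := (norm_nonneg _).trans (hCK 0)
  have hdKc : ∀ i, Continuous (FunctionSpaces.Torus.partialDeriv i (FunctionSpaces.Torus.kernel (d := d) ε)) := fun i =>
    (hKs.partialDeriv i).continuous
  have hCdK : ∀ i, ∃ C, 0 ≤ C ∧ ∀ x, ‖FunctionSpaces.Torus.partialDeriv i (FunctionSpaces.Torus.kernel (d := d) ε) x‖ ≤ C := fun i => by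
    obtain ⟨C, hC⟩ := FunctionSpaces.Torus.exists_forall_norm_le_of_continuous (hdKc i)
    exact ⟨C, (norm_nonneg _).trans (hC 0), hC⟩
  choose CdK hCdK0 hCdK using hCdK
  set C' : ℝ := ∑ i, CdK i with hC'
  have hC'0 : 0 ≤ C' := Finset.sum_nonneg fun i _ => hCdK0 i
  have hCdK' : ∀ i x, ‖FunctionSpaces.Torus.partialDeriv i (FunctionSpaces.Torus.kernel (d := d) ε) x‖ ≤ C' := fun i x =>
    (hCdK i x).trans (Finset.single_le_sum (fun j _ => hCdK0 j) (Finset.mem_univ i))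
  -- joint measurability
  have hm : AEStronglyMeasurable (uncurry u) μ := aestronglyMeasurable_uncurry_restrict_prod_of_stLift h.weak.1
  have hmi : ∀ i, AEStronglyMeasurable (uncurry fun s y => u s y i) μ := fun i => aestronglyMeasurable_uncurry_apply hm i
  have hmij : ∀ i j, AEStronglyMeasurable (uncurry fun s y => u s y i * u s y j) μ := fun i j => (hmi i).mul (hmi j)
  set P : d → d → ℝ × UnitAddTorus d → ℝ := fun i j q => ((fun y => u q.1 y i * u q.1 y j) ⋆ FunctionSpaces.Torus.kernel ε) q.2 with hP
  set Q : d → d → ℝ × UnitAddTorus d → ℝ := fun i j q => ((fun y => u q.1 y j) ⋆ FunctionSpaces.Torus.partialDeriv i (FunctionSpaces.Torus.kernel ε)) q.2 with hQ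
  have hPm : ∀ i j, AEStronglyMeasurable (P i j) μ := fun i j =>
    FunctionSpaces.Torus.aestronglyMeasurable_uncurry_convolution (ContinuousLinearMap.lsmul ℝ ℝ) (hmij i j) hKc
  have hQm : ∀ i j, AEStronglyMeasurable (Q i j) μ := fun i j =>
    FunctionSpaces.Torus.aestronglyMeasurable_uncurry_convolution (ContinuousLinearMap.lsmul ℝ ℝ) (hmi j) (hdKc i)
  set Φ : ℝ × UnitAddTorus d → ℝ := fun q => ∑ i, ∑ j, P i j q * Q i j q with hΦ
  have hΦm : AEStronglyMeasurable Φ μ :=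
    Finset.aestronglyMeasurable_fun_sum _ fun i _ => Finset.aestronglyMeasurable_fun_sum _ fun j _ => (hPm i j).mul (hQm i j)
  have hmeas : AEStronglyMeasurable (fun s => ∫ x, Φ (s, x)) (volume.restrict (Ioo 0 T)) := hΦm.integral_prod_right'
  -- the flux agrees with `∫ Φ` on `(0,T)`
  have hL1 : ∀ s ∈ Icc 0 T, Integrable (u s) volume := fun s hs => (h.memLp s hs).integrable one_le_two
  have heq : ∀ s ∈ Ioo 0 T, cetFlux (FunctionSpaces.Torus.kernel ε) (u s) = ∫ x, Φ (s, x) := by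
    intro s hs
    have hsi : ∀ j, Integrable (fun y => u s y j) volume := fun j =>
      (EuclideanSpace.proj (𝕜 := ℝ) j).integrable_comp (hL1 s (Ioo_subset_Icc_self hs))
    unfold cetFlux
    refine integral_congr_ae (Eventually.of_forall fun x => ?_)
    simp only [hΦ, hP, hQ]
    refine Finset.sum_congr rfl fun i _ => Finset.sum_congr rfl fun j _ => ?_
    rw [FunctionSpaces.Torus.partialDeriv_convolution (hsi j) hKs i x]
  -- uniform bound
  set Bd : ℝ := FunctionSpaces.Torus.kineticEnergy u₀ + ∫ s in Ioo 0 T, ‖∫ x, ⟪f s x, u s x⟫_ℝ‖ with hBd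
  set M : ℝ := (Fintype.card d : ℝ) ^ 2 * ((CK * (2 * Bd)) * (C' * (1 + 2 * Bd))) with hM
  have hbound : ∀ s ∈ Ioo 0 T, ‖cetFlux (FunctionSpaces.Torus.kernel ε) (u s)‖ ≤ M := by
    intro s hs
    have hs' : s ∈ Icc 0 T := Ioo_subset_Icc_self hs
    have hv2 : MemLp (u s) 2 volume := h.memLp s hs'
    have hv1 : Integrable (u s) volume := hL1 s hs'
    have hI1 := h.integral_norm_le hν hA hs'
    have hI2 := h.integral_norm_sq_le hν hA hs'
    have hBd0 : 0 ≤ Bd := by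
      have := FunctionSpaces.Torus.kineticEnergy_nonneg u₀
      have : 0 ≤ ∫ s in Ioo 0 T, ‖∫ x, ⟪f s x, u s x⟫_ℝ‖ := integral_nonneg fun _ => norm_nonneg _
      positivity
    have hpt : ∀ x, ‖Φ (s, x)‖ ≤ M := by
      intro x
      simp only [hΦ]
      calc ‖∑ i, ∑ j, P i j (s, x) * Q i j (s, x)‖ ≤ ∑ i, ‖∑ j, P i j (s, x) * Q i j (s, x)‖ := norm_sum_le _ _
        _ ≤ ∑ i, ∑ j, ‖P i j (s, x) * Q i j (s, x)‖ := Finset.sum_le_sum fun i _ => norm_sum_le _ _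
        _ ≤ ∑ _i : d, ∑ _j : d, (CK * (2 * Bd)) * (C' * (1 + 2 * Bd)) := by
            refine Finset.sum_le_sum fun i _ => Finset.sum_le_sum fun j _ => ?_
            rw [norm_mul, Real.norm_eq_abs, Real.norm_eq_abs]
            refine mul_le_mul ?_ ?_ (abs_nonneg _) (by positivity)
            · exact (abs_mul_convolution_le hv2 hCK hCK0 i j x).trans (mul_le_mul_of_nonneg_left hI2 hCK0)
            · exact (abs_apply_convolution_le hv1 (hCdK' i) hC'0 j x).trans (mul_le_mul_of_nonneg_left hI1 hC'0)
        _ = M := by simp [hM]; ring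
    rw [heq s hs]
    calc ‖∫ x, Φ (s, x)‖ ≤ M * (volume : Measure (UnitAddTorus d)).real univ :=
          norm_integral_le_of_norm_le_const (Eventually.of_forall hpt)
      _ = M := by simp
  have hmeas' : AEStronglyMeasurable (fun s => cetFlux (FunctionSpaces.Torus.kernel ε) (u s)) (volume.restrict (Ioo 0 T)) :=
    hmeas.congr ((ae_restrict_mem measurableSet_Ioo).mono fun s hs => (heq s hs).symm)
  refine Integrable.mono' (integrable_const M) hmeas' ?_
  exact (ae_restrict_mem measurableSet_Ioo).mono fun s hs => hbound s hs

/-- **The resolved dissipation of a Leray–Hopf solution is integrable in time**: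
`s ↦ ‖∇(u(s) ⋆ K_ε)‖₂²` is integrable on `(0,T)` (bounded by `d² ‖∇K‖²_∞ ‖u(s)‖₁²`). [cite: DrivasEyink2019, §2, proof of Lemma 2] -/
theorem IsLerayHopfOn.integrableOn_gradNormSq_vecConv (h : IsLerayHopfOn T ν f u₀ u) (hν : 0 ≤ ν)
    (hA : IntegrableOn (fun s => ∫ x, ⟪f s x, u s x⟫_ℝ) (Ioo 0 T)) {ε : ℝ} (hε : 0 < ε) (hε' : ε ≤ 1 / 4) :
    IntegrableOn (fun s => FunctionSpaces.Torus.gradNormSq (vecConv (u s) (FunctionSpaces.Torus.kernel ε))) (Ioo 0 T) := by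
  set μ : Measure (ℝ × UnitAddTorus d) := (volume.restrict (Ioo 0 T)).prod volume with hμ
  have hKs : FunctionSpaces.Torus.IsSmooth (FunctionSpaces.Torus.kernel (d := d) ε) := FunctionSpaces.Torus.isSmooth_kernel hε hε'
  have hdKc : ∀ i, Continuous (FunctionSpaces.Torus.partialDeriv i (FunctionSpaces.Torus.kernel (d := d) ε)) := fun i =>
    (hKs.partialDeriv i).continuous
  have hCdK : ∀ i, ∃ C, 0 ≤ C ∧ ∀ x, ‖FunctionSpaces.Torus.partialDeriv i (FunctionSpaces.Torus.kernel (d := d) ε) x‖ ≤ C := fun i => by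
    obtain ⟨C, hC⟩ := FunctionSpaces.Torus.exists_forall_norm_le_of_continuous (hdKc i)
    exact ⟨C, (norm_nonneg _).trans (hC 0), hC⟩
  choose CdK hCdK0 hCdK using hCdK
  set C' : ℝ := ∑ i, CdK i with hC'
  have hC'0 : 0 ≤ C' := Finset.sum_nonneg fun i _ => hCdK0 i
  have hCdK' : ∀ i x, ‖FunctionSpaces.Torus.partialDeriv i (FunctionSpaces.Torus.kernel (d := d) ε) x‖ ≤ C' := fun i x =>
    (hCdK i x).trans (Finset.single_le_sum (fun j _ => hCdK0 j) (Finset.mem_univ i))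
  have hm : AEStronglyMeasurable (uncurry u) μ := aestronglyMeasurable_uncurry_restrict_prod_of_stLift h.weak.1
  have hmi : ∀ i, AEStronglyMeasurable (uncurry fun s y => u s y i) μ := fun i => aestronglyMeasurable_uncurry_apply hm i
  set Q : d → d → ℝ × UnitAddTorus d → ℝ := fun j i q => ((fun y => u q.1 y i) ⋆ FunctionSpaces.Torus.partialDeriv j (FunctionSpaces.Torus.kernel ε)) q.2 with hQ
  have hQm : ∀ j i, AEStronglyMeasurable (Q j i) μ := fun j i =>
    FunctionSpaces.Torus.aestronglyMeasurable_uncurry_convolution (ContinuousLinearMap.lsmul ℝ ℝ) (hmi i) (hdKc j)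
  set Φ : ℝ × UnitAddTorus d → ℝ := fun q => ∑ j, ∑ i, Q j i q ^ 2 with hΦ
  have hΦm : AEStronglyMeasurable Φ μ :=
    Finset.aestronglyMeasurable_fun_sum _ fun j _ => Finset.aestronglyMeasurable_fun_sum _ fun i _ => (hQm j i).pow 2
  have hmeas : AEStronglyMeasurable (fun s => ∫ x, Φ (s, x)) (volume.restrict (Ioo 0 T)) := hΦm.integral_prod_right'
  have hL1 : ∀ s ∈ Icc 0 T, Integrable (u s) volume := fun s hs => (h.memLp s hs).integrable one_le_two
  have heq : ∀ s ∈ Ioo 0 T, FunctionSpaces.Torus.gradNormSq (vecConv (u s) (FunctionSpaces.Torus.kernel ε)) = ∫ x, Φ (s, x) := by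
    intro s hs
    have hv1 := hL1 s (Ioo_subset_Icc_self hs)
    have hsi : ∀ j, Integrable (fun y => u s y j) volume := fun j =>
      (EuclideanSpace.proj (𝕜 := ℝ) j).integrable_comp hv1
    have hV1 : FunctionSpaces.Torus.IsContDiff 1 (vecConv (u s) (FunctionSpaces.Torus.kernel ε)) :=
      (FunctionSpaces.Torus.isSmooth_vecMollify hv1 hε hε').isContDiff (by simp)
    unfold FunctionSpaces.Torus.gradNormSq
    refine integral_congr_ae (Eventually.of_forall fun x => ?_)
    simp only [hΦ, hQ]
    refine Finset.sum_congr rfl fun j _ => ?_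
    rw [EuclideanSpace.norm_sq_eq]
    refine Finset.sum_congr rfl fun i _ => ?_
    rw [Real.norm_eq_abs, sq_abs, partialDeriv_apply_eq hV1 j x i]
    show (FunctionSpaces.Torus.partialDeriv j (fun y => vecConv (u s) (FunctionSpaces.Torus.kernel ε) y i) x) ^ 2 = _
    have : (fun y => vecConv (u s) (FunctionSpaces.Torus.kernel ε) y i) = (fun y => u s y i) ⋆ FunctionSpaces.Torus.kernel ε := rfl
    rw [this, FunctionSpaces.Torus.partialDeriv_convolution (hsi i) hKs j x]
  set Bd : ℝ := FunctionSpaces.Torus.kineticEnergy u₀ + ∫ s in Ioo 0 T, ‖∫ x, ⟪f s x, u s x⟫_ℝ‖ with hBd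
  set M : ℝ := (Fintype.card d : ℝ) ^ 2 * (C' * (1 + 2 * Bd)) ^ 2 with hM
  have hbound : ∀ s ∈ Ioo 0 T, ‖FunctionSpaces.Torus.gradNormSq (vecConv (u s) (FunctionSpaces.Torus.kernel ε))‖ ≤ M := by
    intro s hs
    have hs' : s ∈ Icc 0 T := Ioo_subset_Icc_self hs
    have hv1 : Integrable (u s) volume := hL1 s hs'
    have hI1 := h.integral_norm_le hν hA hs'
    have hpt : ∀ x, ‖Φ (s, x)‖ ≤ M := by
      intro x
      simp only [hΦ]
      rw [Real.norm_eq_abs, abs_of_nonneg (Finset.sum_nonneg fun j _ => Finset.sum_nonneg fun i _ => sq_nonneg _)]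
      calc ∑ j, ∑ i, Q j i (s, x) ^ 2 ≤ ∑ _j : d, ∑ _i : d, (C' * (1 + 2 * Bd)) ^ 2 := by
            refine Finset.sum_le_sum fun j _ => Finset.sum_le_sum fun i _ => ?_
            have hq : |Q j i (s, x)| ≤ C' * (1 + 2 * Bd) :=
              (abs_apply_convolution_le hv1 (hCdK' j) hC'0 i x).trans (mul_le_mul_of_nonneg_left hI1 hC'0)
            calc Q j i (s, x) ^ 2 = |Q j i (s, x)| ^ 2 := (sq_abs _).symm
              _ ≤ (C' * (1 + 2 * Bd)) ^ 2 := pow_le_pow_left₀ (abs_nonneg _) hq 2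
        _ = M := by simp [hM]; ring
    rw [heq s hs]
    calc ‖∫ x, Φ (s, x)‖ ≤ M * (volume : Measure (UnitAddTorus d)).real univ :=
          norm_integral_le_of_norm_le_const (Eventually.of_forall hpt)
      _ = M := by simp
  have hmeas' : AEStronglyMeasurable (fun s => FunctionSpaces.Torus.gradNormSq (vecConv (u s) (FunctionSpaces.Torus.kernel ε)))
      (volume.restrict (Ioo 0 T)) :=
    hmeas.congr ((ae_restrict_mem measurableSet_Ioo).mono fun s hs => (heq s hs).symm)
  refine Integrable.mono' (integrable_const M) hmeas' ?_
  exact (ae_restrict_mem measurableSet_Ioo).mono fun s hs => hbound s hs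

/-- **The mollified forcing work of a Leray–Hopf solution is integrable in time**:
`s ↦ ∫⟪f(s) ⋆ K_ε, u(s) ⋆ K_ε⟫` is integrable on `(0,T)` for a jointly measurable `L²_{t,x}`
force (bounded by `d²‖K‖²_∞ ‖u(s)‖₁ ‖f(s)‖₁`, and `s ↦ ‖f(s)‖₁ ∈ L¹(0,T)`). [cite: DrivasEyink2019, §2, proof of Lemma 2] -/
theorem IsLerayHopfOn.integrableOn_integral_inner_vecConv (h : IsLerayHopfOn T ν f u₀ u) (hν : 0 ≤ ν)
    (hfm : AEStronglyMeasurable (FunctionSpaces.Torus.stLift f) (volume.restrict (Ioo 0 T ×ˢ univ)))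
    (hf2 : ∫⁻ t in Ioo 0 T, ∫⁻ x, ‖f t x‖ₑ ^ 2 < ⊤)
    (hA : IntegrableOn (fun s => ∫ x, ⟪f s x, u s x⟫_ℝ) (Ioo 0 T)) {ε : ℝ} (hε : 0 < ε) (hε' : ε ≤ 1 / 4) :
    IntegrableOn (fun s => ∫ x, ⟪vecConv (f s) (FunctionSpaces.Torus.kernel ε) x,
      vecConv (u s) (FunctionSpaces.Torus.kernel ε) x⟫_ℝ) (Ioo 0 T) := by
  classical
  set μ : Measure (ℝ × UnitAddTorus d) := (volume.restrict (Ioo 0 T)).prod volume with hμ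
  have hKc : Continuous (FunctionSpaces.Torus.kernel (d := d) ε) := FunctionSpaces.Torus.continuous_kernel hε hε'
  obtain ⟨CK, hCK⟩ := FunctionSpaces.Torus.exists_forall_norm_le_of_continuous hKc
  have hCK0 : 0 ≤ CK := (norm_nonneg _).trans (hCK 0)
  have hm : AEStronglyMeasurable (uncurry u) μ := aestronglyMeasurable_uncurry_restrict_prod_of_stLift h.weak.1
  have hfm' : AEStronglyMeasurable (uncurry f) μ := aestronglyMeasurable_uncurry_restrict_prod_of_stLift hfm
  -- measurability
  have hmeas : AEStronglyMeasurable (fun s => ∫ x, ⟪vecConv (f s) (FunctionSpaces.Torus.kernel ε) x,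
      vecConv (u s) (FunctionSpaces.Torus.kernel ε) x⟫_ℝ) (volume.restrict (Ioo 0 T)) := by
    have h1 : AEStronglyMeasurable (uncurry fun s x => ⟪vecConv (f s) (FunctionSpaces.Torus.kernel ε) x,
        vecConv (u s) (FunctionSpaces.Torus.kernel ε) x⟫_ℝ) μ :=
      (aestronglyMeasurable_uncurry_vecConv hfm' hKc).inner (𝕜 := ℝ) (aestronglyMeasurable_uncurry_vecConv hm hKc)
    exact h1.integral_prod_right'
  -- `f` is integrable on the strip, hence `s ↦ ∫‖f s‖` is integrable on `(0,T)`
  have hfint : Integrable (uncurry f) μ := by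
    have h2 : MemLp (uncurry f) 2 μ := by
      refine ⟨hfm', ?_⟩
      rw [eLpNorm_eq_lintegral_rpow_enorm_toReal (by norm_num) (by norm_num), ENNReal.toReal_ofNat]
      refine ENNReal.rpow_lt_top_of_nonneg (by norm_num) (ne_of_lt ?_)
      rw [lintegral_prod _ (hfm'.enorm.pow_const _)]
      have h2 : ∀ t x, ‖uncurry f (t, x)‖ₑ ^ (2 : ℝ) = ‖f t x‖ₑ ^ 2 := fun t x => by
        rw [show (2 : ℝ) = ((2 : ℕ) : ℝ) by norm_num, ENNReal.rpow_natCast]; rfl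
      simp_rw [h2]
      exact hf2
    exact h2.integrable one_le_two
  have hfnorm : Integrable (fun s => ∫ y, ‖f s y‖) (volume.restrict (Ioo 0 T)) := hfint.integral_norm_prod_left
  have hfL1 : ∀ᵐ s ∂(volume.restrict (Ioo 0 T)), Integrable (f s) volume := hfint.prod_right_ae
  -- the bound
  set Bd : ℝ := FunctionSpaces.Torus.kineticEnergy u₀ + ∫ s in Ioo 0 T, ‖∫ x, ⟪f s x, u s x⟫_ℝ‖ with hBd
  set Cu : ℝ := Fintype.card d * (CK * (1 + 2 * Bd)) with hCu
  refine Integrable.mono' (hfnorm.const_mul (Cu * (Fintype.card d * CK))) hmeas ?_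
  filter_upwards [ae_restrict_mem measurableSet_Ioo, hfL1] with s hs hfs
  have hs' : s ∈ Icc 0 T := Ioo_subset_Icc_self hs
  have hv1 : Integrable (u s) volume := (h.memLp s hs').integrable one_le_two
  have hI1 := h.integral_norm_le hν hA hs'
  have hU : ∀ x, ‖vecConv (u s) (FunctionSpaces.Torus.kernel ε) x‖ ≤ Cu := fun x =>
    (norm_vecConv_apply_le hv1 hCK hCK0 x).trans (by
      rw [hCu]
      exact mul_le_mul_of_nonneg_left (mul_le_mul_of_nonneg_left hI1 hCK0) (Nat.cast_nonneg _))
  have hF : ∀ x, ‖vecConv (f s) (FunctionSpaces.Torus.kernel ε) x‖ ≤ Fintype.card d * (CK * ∫ y, ‖f s y‖) := fun x =>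
    norm_vecConv_apply_le hfs hCK hCK0 x
  have hCu0 : 0 ≤ Cu := (norm_nonneg _).trans (hU 0)
  calc ‖∫ x, ⟪vecConv (f s) (FunctionSpaces.Torus.kernel ε) x, vecConv (u s) (FunctionSpaces.Torus.kernel ε) x⟫_ℝ‖
      ≤ (Fintype.card d * (CK * ∫ y, ‖f s y‖)) * Cu * (volume : Measure (UnitAddTorus d)).real univ := by
        refine norm_integral_le_of_norm_le_const (Eventually.of_forall fun x => ?_)
        exact (norm_inner_le_norm _ _).trans (mul_le_mul (hF x) (hU x) (norm_nonneg _)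
          (by have := norm_nonneg (vecConv (f s) (FunctionSpaces.Torus.kernel ε) x); linarith [hF x]))
    _ = Cu * (Fintype.card d * CK) * ∫ y, ‖f s y‖ := by simp; ring

end Integrability


/-! ## Continuity in time of the resolved energy of a Leray–Hopf solution -/

section Continuity

variable [DecidableEq d] {T ν : ℝ} {f u : ℝ → UnitAddTorus d → EuclideanSpace ℝ d}
  {u₀ : UnitAddTorus d → EuclideanSpace ℝ d}

omit [DecidableEq d] in
/-- A component of the mollified field as a pairing: `(v ⋆ K)(x)ᵢ = ∫⟪v(y), K(x - y) eᵢ⟫ dy`. [folklore] -/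
theorem vecConv_apply_eq_integral_inner [DecidableEq d] (v : UnitAddTorus d → EuclideanSpace ℝ d)
    (K : UnitAddTorus d → ℝ) (x : UnitAddTorus d) (i : d) :
    vecConv v K x i = ∫ y, ⟪v y, K (x - y) • EuclideanSpace.single i (1 : ℝ)⟫_ℝ := by
  rw [vecConv_apply, convolution_lsmul]
  refine integral_congr_ae (Eventually.of_forall fun y => ?_)
  show v y i • K (x - y) = ⟪v y, K (x - y) • EuclideanSpace.single i (1 : ℝ)⟫_ℝ
  rw [inner_smul_right, EuclideanSpace.inner_single_right]
  simp [smul_eq_mul, mul_comm]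

/-- **The resolved energy of a Leray–Hopf solution is continuous on `(0,T]` and attains
`E(u₀ ⋆ K)` at `0⁺`**: each component `(u(t) ⋆ K)(x)ᵢ = ∫⟪u(t), K(x-·)eᵢ⟫` is continuous in `t`
by the weak `L²` continuity of `u` (field `weak_continuous` of `Torus.IsLerayHopfOn`), and
`|(u(t) ⋆ K)(x)ᵢ| ≤ ‖K‖_∞ ‖u(t)‖₁` is bounded uniformly in `t` by the energy bound, so dominated
convergence on the compact torus applies to `E(u(t) ⋆ K) = ½∫‖(u(t) ⋆ K)(x)‖² dx`. [folklore] -/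
theorem IsLerayHopfOn.continuousOn_kineticEnergy_vecConv (h : IsLerayHopfOn T ν f u₀ u) (hν : 0 ≤ ν)
    (hT : 0 < T)
    (hA : IntegrableOn (fun s => ∫ x, ⟪f s x, u s x⟫_ℝ) (Ioo 0 T)) {ε : ℝ} (hε : 0 < ε) (hε' : ε ≤ 1 / 4) :
    ContinuousOn (fun t => FunctionSpaces.Torus.kineticEnergy (vecConv (u t) (FunctionSpaces.Torus.kernel ε))) (Ioc 0 T) ∧
      Tendsto (fun t => FunctionSpaces.Torus.kineticEnergy (vecConv (u t) (FunctionSpaces.Torus.kernel ε))) (𝓝[>] 0)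
        (𝓝 (FunctionSpaces.Torus.kineticEnergy (vecConv u₀ (FunctionSpaces.Torus.kernel ε)))) := by
  have hKc : Continuous (FunctionSpaces.Torus.kernel (d := d) ε) := FunctionSpaces.Torus.continuous_kernel hε hε'
  obtain ⟨CK, hCK⟩ := FunctionSpaces.Torus.exists_forall_norm_le_of_continuous hKc
  have hCK0 : 0 ≤ CK := (norm_nonneg _).trans (hCK 0)
  set K := FunctionSpaces.Torus.kernel (d := d) ε with hK
  -- the test vectors `K(x - ·) eᵢ ∈ L²`
  have hw : ∀ (x : UnitAddTorus d) (i : d), MemLp (fun y => K (x - y) • EuclideanSpace.single i (1 : ℝ)) 2 volume :=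
    fun x i => ((hKc.comp (continuous_const.sub continuous_id)).smul continuous_const).memLp_of_hasCompactSupport
      (HasCompactSupport.of_compactSpace _)
  -- components: continuity on `(0,T]` and limit at `0⁺`
  have hcomp : ∀ x i, ContinuousOn (fun t => vecConv (u t) K x i) (Ioc 0 T) ∧
      Tendsto (fun t => vecConv (u t) K x i) (𝓝[>] 0) (𝓝 (vecConv u₀ K x i)) := by
    intro x i
    have hwc := h.weak_continuous _ (hw x i)
    simp_rw [vecConv_apply_eq_integral_inner]
    exact hwc
  -- the integrands `F t x = ‖(u t ⋆ K)(x)‖²`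
  set F : ℝ → UnitAddTorus d → ℝ := fun t x => ‖vecConv (u t) K x‖ ^ 2 with hF
  have hFc : ∀ x, ContinuousOn (fun t => F t x) (Ioc 0 T) := by
    intro x
    have h1 : ContinuousOn (fun t => ∑ i, (vecConv (u t) K x i) ^ 2) (Ioc 0 T) :=
      continuousOn_finsetSum _ fun i _ => ((hcomp x i).1.pow 2)
    refine h1.congr fun t _ => ?_
    simp only [hF]
    rw [EuclideanSpace.norm_sq_eq]
    exact Finset.sum_congr rfl fun i _ => by rw [Real.norm_eq_abs, sq_abs]
  have hFlim : ∀ x, Tendsto (fun t => F t x) (𝓝[>] 0) (𝓝 (‖vecConv u₀ K x‖ ^ 2)) := by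
    intro x
    have h1 : Tendsto (fun t => ∑ i, (vecConv (u t) K x i) ^ 2) (𝓝[>] 0) (𝓝 (∑ i, (vecConv u₀ K x i) ^ 2)) :=
      tendsto_finsetSum _ fun i _ => ((hcomp x i).2.pow 2)
    have e1 : ∀ t, F t x = ∑ i, (vecConv (u t) K x i) ^ 2 := fun t => by
      simp only [hF]; rw [EuclideanSpace.norm_sq_eq]
      exact Finset.sum_congr rfl fun i _ => by rw [Real.norm_eq_abs, sq_abs]
    have e2 : ‖vecConv u₀ K x‖ ^ 2 = ∑ i, (vecConv u₀ K x i) ^ 2 := by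
      rw [EuclideanSpace.norm_sq_eq]
      exact Finset.sum_congr rfl fun i _ => by rw [Real.norm_eq_abs, sq_abs]
    simp_rw [e1, e2]
    exact h1
  -- uniform bound on `(0,T]`
  set Bd : ℝ := FunctionSpaces.Torus.kineticEnergy u₀ + ∫ s in Ioo 0 T, ‖∫ x, ⟪f s x, u s x⟫_ℝ‖ with hBd
  set M : ℝ := (Fintype.card d * (CK * (1 + 2 * Bd))) ^ 2 with hM
  have hbound : ∀ t ∈ Ioc 0 T, ∀ x, ‖F t x‖ ≤ M := by
    intro t ht x
    have ht' : t ∈ Icc 0 T := ⟨ht.1.le, ht.2⟩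
    have hv1 : Integrable (u t) volume := (h.memLp t ht').integrable one_le_two
    have hb := (norm_vecConv_apply_le hv1 hCK hCK0 x).trans
      (mul_le_mul_of_nonneg_left (mul_le_mul_of_nonneg_left (h.integral_norm_le hν hA ht') hCK0) (Nat.cast_nonneg _))
    simp only [hF, Real.norm_eq_abs, abs_pow, abs_norm]
    exact pow_le_pow_left₀ (norm_nonneg _) hb 2
  have hFm : ∀ t ∈ Ioc 0 T, AEStronglyMeasurable (F t) volume := fun t ht =>
    ((continuous_vecConv ((h.memLp t ⟨ht.1.le, ht.2⟩).integrable one_le_two) hKc).norm.pow 2).aestronglyMeasurable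
  have hE : ∀ v : UnitAddTorus d → EuclideanSpace ℝ d, FunctionSpaces.Torus.kineticEnergy (vecConv v K) = 2⁻¹ * ∫ x, ‖vecConv v K x‖ ^ 2 :=
    fun v => rfl
  constructor
  · -- continuity on `(0,T]`
    simp_rw [hE]
    refine ContinuousOn.mul continuousOn_const ?_
    exact continuousOn_of_dominated (bound := fun _ => M) hFm (fun t ht => Eventually.of_forall (hbound t ht))
      (integrable_const M) (Eventually.of_forall hFc)
  · -- limit at `0⁺`
    simp_rw [hE]
    refine Tendsto.const_mul 2⁻¹ ?_
    have hev : ∀ᶠ t in 𝓝[>] (0 : ℝ), t ∈ Ioc 0 T := Ioc_mem_nhdsGT hT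
    exact tendsto_integral_filter_of_dominated_convergence (fun _ => M) (hev.mono fun t ht => hFm t ht)
      (hev.mono fun t ht => Eventually.of_forall (hbound t ht)) (integrable_const M) (Eventually.of_forall hFlim)

end Continuity


/-! ## The discharge: from the distributional to the pointwise balance -/

section Discharge

variable [DecidableEq d]

omit [DecidableEq d] in
/-- **The forcing work is integrable in time** for jointly measurable `L²_{t,x}` force and
velocity: `s ↦ ∫⟪f(s), u(s)⟫` is integrable on `(0,T)` (`|⟪f,u⟫| ≤ ½‖f‖² + ½‖u‖²` on the
product, then Fubini). [folklore] -/
theorem integrableOn_integral_inner_of_sq {T : ℝ} {f u : ℝ → UnitAddTorus d → EuclideanSpace ℝ d}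
    (hf : AEStronglyMeasurable (uncurry f) ((volume.restrict (Ioo 0 T)).prod volume))
    (hu : AEStronglyMeasurable (uncurry u) ((volume.restrict (Ioo 0 T)).prod volume))
    (hf2 : ∫⁻ t in Ioo 0 T, ∫⁻ x, ‖f t x‖ₑ ^ 2 < ⊤) (hu2 : ∫⁻ t in Ioo 0 T, ∫⁻ x, ‖u t x‖ₑ ^ 2 < ⊤) :
    IntegrableOn (fun s => ∫ x, ⟪f s x, u s x⟫_ℝ) (Ioo 0 T) := by
  set μ : Measure (ℝ × UnitAddTorus d) := (volume.restrict (Ioo 0 T)).prod volume with hμ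
  have hmem : ∀ {g : ℝ → UnitAddTorus d → EuclideanSpace ℝ d},
      AEStronglyMeasurable (uncurry g) μ → (∫⁻ t in Ioo 0 T, ∫⁻ x, ‖g t x‖ₑ ^ 2 < ⊤) →
      MemLp (uncurry g) 2 μ := by
    intro g hg hg2
    refine ⟨hg, ?_⟩
    rw [eLpNorm_eq_lintegral_rpow_enorm_toReal (by norm_num) (by norm_num), ENNReal.toReal_ofNat]
    refine ENNReal.rpow_lt_top_of_nonneg (by norm_num) (ne_of_lt ?_)
    rw [lintegral_prod _ (hg.enorm.pow_const _)]
    have h2 : ∀ t x, ‖uncurry g (t, x)‖ₑ ^ (2 : ℝ) = ‖g t x‖ₑ ^ 2 := fun t x => by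
      rw [show (2 : ℝ) = ((2 : ℕ) : ℝ) by norm_num, ENNReal.rpow_natCast]; rfl
    simp_rw [h2]
    exact hg2
  have hF : Integrable (uncurry fun s x => ⟪f s x, u s x⟫_ℝ) μ := by
    have hfm := hmem hf hf2
    have hum := hmem hu hu2
    refine Integrable.mono' (((hfm.integrable_norm_pow two_ne_zero).const_mul 2⁻¹).add
      ((hum.integrable_norm_pow two_ne_zero).const_mul 2⁻¹)) (hf.inner (𝕜 := ℝ) hu) (ae_of_all _ fun z => ?_)
    simp only [uncurry, Pi.add_apply, Real.norm_eq_abs]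
    have h1 := abs_real_inner_le_norm (f z.1 z.2) (u z.1 z.2)
    nlinarith [sq_nonneg (‖f z.1 z.2‖ - ‖u z.1 z.2‖), norm_nonneg (f z.1 z.2), norm_nonneg (u z.1 z.2)]
  exact hF.integral_prod_left

omit [DecidableEq d] in
/-- A bounded continuous weight preserves integrability on a set: `θ · X ∈ L¹(S)` for
`X ∈ L¹(S)` and continuous `θ` with `|θ| ≤ C`. [folklore] -/
theorem integrableOn_continuous_mul {S : Set ℝ} {X θ : ℝ → ℝ} (hX : IntegrableOn X S) (hθ : Continuous θ)
    {C : ℝ} (hC : ∀ s, |θ s| ≤ C) : IntegrableOn (fun s => θ s * X s) S :=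
  Integrable.bdd_mul hX hθ.aestronglyMeasurable (Eventually.of_forall fun s => by rw [Real.norm_eq_abs]; exact hC s)

/-- **Discharge of `Torus.IsLerayHopfOn.resolvedEnergyBalance`** (Drivas–Eyink 2019, Lemma 2,
the display "global balance of resolved energy" of its proof in §2): for a Leray–Hopf solution
on `T^d × [0,T]` with `ν > 0`, solenoidal measurable `L²_{t,x}` force, `L²` datum and
`u ∈ L³_{t,x}`, and the mollifier `K_ε`, the three right-hand sides are integrable on `(0,T)`
(`IsLerayHopfOn.integrableOn_cetFlux`, `…_gradNormSq_vecConv`, `…_integral_inner_vecConv`)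
and `E(ū(t)) - E(ū₀) = ∫₀ᵗ Π_K - ν∫₀ᵗ‖∇ū‖₂² + ∫₀ᵗ∫⟪f̄, ū⟫` for every `t ∈ (0,T]`. Proof: by
the distributional balance (`Torus.IsWeakNSSolutionForcedOn.resolvedEnergyBalance_distrib`) and
an integration by parts against the primitive `V(t) = ∫₀ᵗ g` of the integrable right-hand side
`g` (`Literature.Analysis.FunctionSpaces.setIntegral_deriv_mul_primitive`), `E(ū) - V` has
vanishing distributional derivative on `(0,T)`, hence is a.e. constant
(`Literature.Analysis.FunctionSpaces.ae_eq_const_of_forall_setIntegral_deriv_mul_eq_zero`),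
hence constant on `(0,T]` since `t ↦ E(ū(t))` is continuous there
(`IsLerayHopfOn.continuousOn_kineticEnergy_vecConv`, weak `L²` continuity), and the constant is
`E(ū₀)` by the weak attainment of the datum at `0⁺` (the printed argument instead integrates the
pointwise-in-`x` balance of the absolutely continuous `t ↦ ū_ℓ(x,t)`). [cite: DrivasEyink2019, Lemma 2 and §2, proof of Lemma 2] -/
theorem IsLerayHopfOn.resolvedEnergyBalance_holds : IsLerayHopfOn.resolvedEnergyBalance (d := d) := by
  intro T ν f u u₀ hν h hfdiv hf hf2 hu₀ hu3 ε hε hε'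
  rcases le_or_gt T 0 with hT | hT
  · refine ⟨?_, ?_, ?_, fun t ht => absurd (ht.1.trans_le ht.2) (not_lt.2 hT)⟩ <;>
      simp [Ioo_eq_empty_of_le hT, integrableOn_empty]
  set K := FunctionSpaces.Torus.kernel (d := d) ε with hK
  have hum : AEStronglyMeasurable (uncurry u) ((volume.restrict (Ioo 0 T)).prod volume) :=
    aestronglyMeasurable_uncurry_restrict_prod_of_stLift h.weak.1
  have hfm' : AEStronglyMeasurable (uncurry f) ((volume.restrict (Ioo 0 T)).prod volume) :=
    aestronglyMeasurable_uncurry_restrict_prod_of_stLift hf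
  have hA : IntegrableOn (fun s => ∫ x, ⟪f s x, u s x⟫_ℝ) (Ioo 0 T) :=
    integrableOn_integral_inner_of_sq hfm' hum hf2 h.weak.2.1
  have hI1 := h.integrableOn_cetFlux hν.le hA hε hε'
  have hI2 := h.integrableOn_gradNormSq_vecConv hν.le hA hε hε'
  have hI3 := h.integrableOn_integral_inner_vecConv hν.le hf hf2 hA hε hε'
  refine ⟨hI1, hI2, hI3, ?_⟩
  -- the right-hand side `g`, its zero extension and primitive
  set cf : ℝ → ℝ := fun s => cetFlux K (u s) with hcf
  set gn : ℝ → ℝ := fun s => FunctionSpaces.Torus.gradNormSq (vecConv (u s) K) with hgn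
  set P : ℝ → ℝ := fun s => ∫ x, ⟪vecConv (f s) K x, vecConv (u s) K x⟫_ℝ with hP
  set g : ℝ → ℝ := fun s => cf s - ν * gn s + P s with hg
  have hgI : IntegrableOn g (Ioo 0 T) := (hI1.sub (hI2.const_mul ν)).add hI3
  set gz : ℝ → ℝ := (Ioo 0 T).indicator g with hgz
  have hgzI : Integrable gz volume := hgI.integrable_indicator measurableSet_Ioo
  set V : ℝ → ℝ := fun t => ∫ s in (0 : ℝ)..t, gz s with hV
  have hVc : Continuous V := intervalIntegral.continuous_primitive (fun a b => hgzI.intervalIntegrable) 0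
  have hV0 : V 0 = 0 := intervalIntegral.integral_same
  have hVt : ∀ t, 0 ≤ t → V t = ∫ s in Ioc 0 t, gz s := fun t ht => intervalIntegral.integral_of_le ht
  -- the resolved energy
  set φ : ℝ → ℝ := fun t => FunctionSpaces.Torus.kineticEnergy (vecConv (u t) K) with hφ
  obtain ⟨hφc, hφ0⟩ := h.continuousOn_kineticEnergy_vecConv hν.le hT hA hε hε'
  -- uniform bound for `φ` on `(0,T]`
  set Bd : ℝ := FunctionSpaces.Torus.kineticEnergy u₀ + ∫ s in Ioo 0 T, ‖∫ x, ⟪f s x, u s x⟫_ℝ‖ with hBd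
  have hφb : ∀ t ∈ Ioc 0 T, ‖φ t‖ ≤ Bd := by
    intro t ht
    have ht' : t ∈ Icc 0 T := ⟨ht.1.le, ht.2⟩
    rw [Real.norm_eq_abs, abs_of_nonneg (FunctionSpaces.Torus.kineticEnergy_nonneg _)]
    exact (kineticEnergy_vecConv_kernel_le (h.memLp t ht') hε hε').trans (h.kineticEnergy_le hν.le hA ht')
  -- integrability of `φ - V` on `(0,T)`
  have hφI : IntegrableOn φ (Ioo 0 T) := by
    have hm : AEStronglyMeasurable φ (volume.restrict (Ioo 0 T)) :=
      (hφc.mono Ioo_subset_Ioc_self).aestronglyMeasurable measurableSet_Ioo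
    refine Integrable.mono' (integrable_const Bd) hm ?_
    exact (ae_restrict_mem measurableSet_Ioo).mono fun t ht => hφb t (Ioo_subset_Ioc_self ht)
  have hVI : IntegrableOn V (Ioo 0 T) :=
    (hVc.continuousOn.integrableOn_compact isCompact_Icc).mono_set Ioo_subset_Icc_self
  have hφVI : IntegrableOn (fun t => φ t - V t) (Ioo 0 T) := hφI.sub hVI
  -- the distributional identity `∫ θ' (φ - V) = 0`
  have hdist : ∀ θ : ℝ → ℝ, ContDiff ℝ ∞ θ → HasCompactSupport θ → tsupport θ ⊆ Ioo 0 T →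
      ∫ t in Ioo 0 T, deriv θ t * (φ t - V t) = 0 := by
    intro θ hθ hθc hθT
    have hB1 := IsWeakNSSolutionForcedOn.resolvedEnergyBalance_distrib h.weak hf hf2 hu3 hε hε' hθ hθc hθT
    obtain ⟨Cθ, hCθ⟩ := FunctionSpaces.exists_forall_abs_le_of_hasCompactSupport hθ.continuous hθc
    have hθ'c : Continuous (deriv θ) := hθ.continuous_deriv (by simp)
    obtain ⟨Cθ', hCθ'⟩ := FunctionSpaces.exists_forall_abs_le_of_hasCompactSupport hθ'c hθc.deriv
    -- integration by parts against the primitive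
    have hibp := FunctionSpaces.setIntegral_deriv_mul_primitive (F := gz) hgzI.integrableOn
      (hθ.of_le (by norm_cast)) hθc (hθT.trans Ioo_subset_Iio_self)
    have hibp' : ∫ s in Ioo 0 T, deriv θ s * V s = -∫ s in Ioo 0 T, θ s * gz s := by
      rw [← hibp]
      refine setIntegral_congr_fun measurableSet_Ioo fun s hs => ?_
      rw [hVt s hs.1.le]
    -- `∫ θ gz = ∫ θ cf - ν ∫ θ gn + ∫ θ P` on `(0,T)`
    have hsplit : ∫ s in Ioo 0 T, θ s * gz s =
        (∫ s in Ioo 0 T, θ s * cf s) - ν * (∫ s in Ioo 0 T, θ s * gn s) + ∫ s in Ioo 0 T, θ s * P s := by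
      have e1 : ∫ s in Ioo 0 T, θ s * gz s = ∫ s in Ioo 0 T, (θ s * cf s - ν * (θ s * gn s) + θ s * P s) := by
        refine setIntegral_congr_fun measurableSet_Ioo fun s hs => ?_
        simp only [hgz, indicator_of_mem hs, hg]
        ring
      rw [e1, integral_add, integral_sub, integral_const_mul]
      · exact integrableOn_continuous_mul hI1 hθ.continuous hCθ
      · exact (integrableOn_continuous_mul hI2 hθ.continuous hCθ).const_mul ν
      · exact (integrableOn_continuous_mul hI1 hθ.continuous hCθ).sub
          ((integrableOn_continuous_mul hI2 hθ.continuous hCθ).const_mul ν)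
      · exact integrableOn_continuous_mul hI3 hθ.continuous hCθ
    have e2 : ∫ t in Ioo 0 T, deriv θ t * (φ t - V t) =
        (∫ t in Ioo 0 T, deriv θ t * φ t) - ∫ t in Ioo 0 T, deriv θ t * V t := by
      simp_rw [mul_sub]
      exact integral_sub (integrableOn_continuous_mul hφI hθ'c hCθ') (integrableOn_continuous_mul hVI hθ'c hCθ')
    rw [e2, hibp', hsplit]
    have e3 : (∫ t in Ioo 0 T, deriv θ t * φ t) =
        -(∫ t in Ioo 0 T, θ t * cf t) + ν * (∫ t in Ioo 0 T, θ t * gn t) - ∫ t in Ioo 0 T, θ t * P t := hB1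
    rw [e3]
    ring
  -- a.e. constancy, then constancy on `(0,T]` by continuity
  obtain ⟨c, hc⟩ := FunctionSpaces.ae_eq_const_of_forall_setIntegral_deriv_mul_eq_zero hφVI hdist
  have hae' : (fun t => φ t - V t) =ᵐ[volume.restrict (Ioc 0 T)] fun _ => c := by
    rw [← Measure.restrict_congr_set (Ioo_ae_eq_Ioc (μ := (volume : Measure ℝ)) (a := 0) (b := T))]
    exact hc
  have heq : EqOn (fun t => φ t - V t) (fun _ => c) (Ioc 0 T) := by
    refine Measure.eqOn_of_ae_eq hae' (hφc.sub hVc.continuousOn) continuousOn_const ?_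
    rw [interior_Ioc, closure_Ioo hT.ne]
    exact Ioc_subset_Icc_self
  -- the constant is `E(ū₀)`
  have hc0 : c = FunctionSpaces.Torus.kineticEnergy (vecConv u₀ K) := by
    have h1 : Tendsto (fun t => φ t - V t) (𝓝[>] 0)
        (𝓝 (FunctionSpaces.Torus.kineticEnergy (vecConv u₀ K) - 0)) := by
      refine hφ0.sub ?_
      have := (hVc.tendsto 0).mono_left (nhdsWithin_le_nhds (s := Ioi (0 : ℝ)))
      rwa [hV0] at this
    have h2 : Tendsto (fun t => φ t - V t) (𝓝[>] 0) (𝓝 c) := by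
      refine tendsto_const_nhds.congr' ?_
      filter_upwards [Ioc_mem_nhdsGT hT] with t ht
      exact (heq ht).symm
    have := tendsto_nhds_unique h2 h1
    rw [this, sub_zero]
  -- conclusion
  intro t ht
  have hmain : φ t - V t = FunctionSpaces.Torus.kineticEnergy (vecConv u₀ K) := by rw [← hc0]; exact heq ht
  have hsub : Ioo 0 t ⊆ Ioo 0 T := Ioo_subset_Ioo_right ht.2
  have hVval : V t = (∫ s in Ioo 0 t, cf s) - ν * (∫ s in Ioo 0 t, gn s) + ∫ s in Ioo 0 t, P s := by
    rw [hVt t ht.1.le, integral_Ioc_eq_integral_Ioo]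
    have e1 : ∫ s in Ioo 0 t, gz s = ∫ s in Ioo 0 t, (cf s - ν * gn s + P s) := by
      refine setIntegral_congr_fun measurableSet_Ioo fun s hs => ?_
      simp only [hgz, indicator_of_mem (hsub hs), hg]
    rw [e1, integral_add, integral_sub, integral_const_mul]
    · exact hI1.mono_set hsub
    · exact (hI2.mono_set hsub).const_mul ν
    · exact (hI1.mono_set hsub).sub ((hI2.mono_set hsub).const_mul ν)
    · exact hI3.mono_set hsub
  simp only [hφ, hcf, hgn, hP] at hmain hVval
  linarith

end Discharge

end Torus

end Literature.Analysis.FluidPDE
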